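import Literature.NumberTheory.Transcendental.CurvePeriodsEllipticSegmentsProofs
import Mathlib.Analysis.ODE.Gronwall
import HarnessLib

/-!
# Periods of curve type on an elliptic curve, III: lifting paths through `φ = (℘, ℘′/2)`

Companion of `CurvePeriodsEllipticSegmentsProofs.lean`. For the Weierstrass curve
`E_L : y² = x³ − (g₂/4)x − g₃/4` of a period pair `L` and its uniformisation
`φ(z) = (℘(z), ℘′(z)/2)` we prove the **path lifting property** used by the genus-one case of
Huber–Wüstholz's Theorem 13.3 (2) (book §3.3.1: classes of `H₁(C, D; ℤ)` are represented by
differentiable paths; §18.1: on `E` one integrates `dz = exp_E^* ω` along lifts to `ℂ = Lie E`):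

* `Ell.exists_lift` — every `C¹` path `γ : [0,1] → E_L(ℂ)` (a `CurvePath` of the rendering) is
  `γ = φ ∘ γ̃` on `[0,1]` for a `C¹` map `γ̃ : ℝ → ℂ ∖ Λ` (on `[0,1]`).

The lift is EXPLICIT: `γ̃(t) = z₀ + ½ ∫₀ᵗ θ₀(γ(s))·γ′(s) ds` with `φ(z₀) = γ(0)` (`℘` takes every
value, `PeriodPair.exists_weierstrassP_eq`) — the primitive of the pull-back of `dz = ½ θ₀`
(`θ₀ = dx/y` as a polynomial form, `CurvePeriodsEllipticFormsProofs.lean`; no division by `y` is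
needed). That `φ ∘ γ̃ = γ`: both solve the non-autonomous polynomial system
`w′ = c(t) · (2w₁, 3w₀² + A)` with the same initial value (`γ` because its velocity is tangent,
`Ell.fderiv_mul_theta0_apply` and `Weier.z_one_mul_theta0_apply`; `φ∘γ̃` by `℘″ = 6℘² − g₂/2`),
so they agree as long as `γ̃` stays off `Λ` (Mathlib's `ODE_solution_unique_of_mem_Icc_right`,
`Ell.lift_eqOn`); and `γ̃` never reaches `Λ`, since at the first such time `℘(γ̃(t)) = x(t)` would
be unbounded (`PeriodPair.tendsto_weierstrassP_cobounded`).

## References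

* A. Huber, G. Wüstholz, *Transcendence and Linear Relations of 1-Periods*, Cambridge Tracts in
  Mathematics 227, CUP 2022 [HuberWustholz2022]: §3.3.1 (p. 44), §18.1 (p. 160), Thm. 13.3 (2).
* J. H. Silverman, *The Arithmetic of Elliptic Curves*, GTM 106, Prop. VI.3.6 (b).
-/

noncomputable section

open scoped BigOperators
open scoped PeriodPair
open scoped Topology
open MvPolynomial Set Complex Filter Metric Bornology

namespace Literature.NumberTheory.Transcendental

namespace CurvePeriods

namespace Ell

variable (L : PeriodPair)

/-! ### `φ` is onto `E_L(ℂ)` -/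

/-- **Every point of `E_L(ℂ)` is `φ(z)` for some `z ∉ Λ`** (`℘` takes every value; the sign of
`y` is adjusted by `z ↦ −z`). [cite: SilvermanAEC2009, Prop. VI.3.6 (b)] -/
theorem exists_phi_eq {p : Fin 2 → ℂ} (hp : p ∈ (curve L).points) :
    ∃ z, z ∉ L.lattice ∧ phi L z = p := by
  rw [Weier.mem_points_iff, Weier.eval_fPoly] at hp
  obtain ⟨z, hz, hx⟩ := L.exists_weierstrassP_eq (p 0)
  have hsq : (℘'[L] z / 2) ^ 2 = p 1 ^ 2 := by
    rw [hp, ← hx]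
    have h := L.derivWeierstrassP_sq z hz
    simp only [A, B]
    linear_combination (1 / 4 : ℂ) * h
  rcases sq_eq_sq_iff_eq_or_eq_neg.1 hsq with h | h
  · refine ⟨z, hz, ?_⟩
    funext k
    fin_cases k
    · simpa using hx
    · simpa using h
  · refine ⟨-z, fun h' => hz (by simpa using neg_mem h'), ?_⟩
    rw [phi_neg]
    funext k
    fin_cases k
    · simpa using hx
    · simp [h]

/-! ### The second tangent identity: `f′(x) · θ₀ = 2 dy` on tangent vectors -/

/-- For `z ∈ E_L` and `v` tangent at `z`: `(3z₀² + A) · θ₀(z)(v) = 2 v₁` (together with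
`z₁ · θ₀(z)(v) = v₀`, `Weier.z_one_mul_theta0_apply`: the velocity of a path on `E_L` is
`(θ₀(γ′)/2) · (2y, 3x² + A)`). [folklore] -/
theorem fderiv_mul_theta0_apply {z v : Fin 2 → ℂ} (hz : z ∈ (curve L).points)
    (hv : v ∈ (curve L).tangentSpace z) :
    (3 * z 0 ^ 2 + A L) * (∑ k, eval z (theta0 L k) * v k) = 2 * v 1 := by
  have hc := (Weier.mem_points_iff (A L) (B L) z).1 hz
  rw [Weier.eval_fPoly] at hc
  rw [Weier.mem_tangentSpace_iff, Weier.eval_pderiv_zero_fPoly] at hv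
  have hb := Weier.eval_bezout (A L) (B L) z
  rw [Weier.eval_pderiv_zero_fPoly, Weier.eval_fPoly] at hb
  have hD := disc_ne_zero L
  simp only [Weier.theta0, Fin.sum_univ_two, Matrix.cons_val_zero, Matrix.cons_val_one, map_mul,
    eval_C, eval_X]
  field_simp
  linear_combination (eval z (Weier.uPol (A L) (B L)) * z 1) * hv +
    (-2 * eval z (Weier.uPol (A L) (B L)) * v 1) * hc + (2 * v 1) * hb

/-! ### The vector field `V(w) = (2w₁, 3w₀² + A)` -/

/-- `V(w) = (2w₁, 3w₀² + A)`: `φ′(z) = V(φ(z))` (`℘′ = 2y`, `℘″/2 = 3x² + A`). [folklore] -/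
def vf (w : Fin 2 → ℂ) : Fin 2 → ℂ := ![2 * w 1, 3 * w 0 ^ 2 + A L]

/-- [folklore] -/
@[simp] theorem vf_apply_zero (w : Fin 2 → ℂ) : vf L w 0 = 2 * w 1 := rfl

/-- [folklore] -/
@[simp] theorem vf_apply_one (w : Fin 2 → ℂ) : vf L w 1 = 3 * w 0 ^ 2 + A L := rfl

/-- `φ′ = V ∘ φ`. [folklore] -/
theorem phiD_eq_vf (z : ℂ) : phiD L z = vf L (phi L z) := by
  funext k
  fin_cases k
  · simp [vf, phiD, phi]
    ring
  · simp [vf, phiD, phi, A]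
    ring

/-- `V` is Lipschitz on every ball (it is polynomial). [folklore] -/
theorem dist_vf_le {R : ℝ} (hR : 0 ≤ R) {w w' : Fin 2 → ℂ} (hw : w ∈ closedBall (0 : Fin 2 → ℂ) R)
    (hw' : w' ∈ closedBall (0 : Fin 2 → ℂ) R) :
    dist (vf L w) (vf L w') ≤ (2 + 6 * R) * dist w w' := by
  have hd : 0 ≤ dist w w' := dist_nonneg
  have h0 := dist_le_pi_dist w w' 0
  have h1 := dist_le_pi_dist w w' 1
  rw [mem_closedBall_zero_iff] at hw hw'
  have hw0 : ‖w 0‖ ≤ R := (norm_le_pi_norm w 0).trans hw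
  have hw0' : ‖w' 0‖ ≤ R := (norm_le_pi_norm w' 0).trans hw'
  refine (dist_pi_le_iff (by positivity)).2 (Fin.forall_fin_two.2 ⟨?_, ?_⟩)
  · rw [vf_apply_zero, vf_apply_zero]
    rw [dist_eq_norm] at h1 ⊢
    have e : 2 * w 1 - 2 * w' 1 = 2 * (w 1 - w' 1) := by ring
    rw [e, norm_mul, Complex.norm_two]
    nlinarith
  · rw [vf_apply_one, vf_apply_one]
    rw [dist_eq_norm] at h0 ⊢
    have e : 3 * w 0 ^ 2 + A L - (3 * w' 0 ^ 2 + A L) = 3 * ((w 0 - w' 0) * (w 0 + w' 0)) := by ring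
    rw [e, norm_mul, norm_mul, Complex.norm_ofNat]
    have hs : ‖w 0 + w' 0‖ ≤ R + R := (norm_add_le _ _).trans (add_le_add hw0 hw0')
    have hn : 0 ≤ ‖w 0 - w' 0‖ := norm_nonneg _
    nlinarith [mul_le_mul h0 hs (norm_nonneg _) hd]

/-! ### Velocities of paths on `E_L` -/

/-- **The one-sided velocity of a `C¹` path on a curve is tangent at every `t ∈ [0,1]`**
(differentiate `Fⱼ(γ(t)) ≡ 0` within `[0,1]`). [folklore] -/
theorem derivWithin_mem_tangentSpace {Z : CurveData} (γ : CurvePath Z) {t : ℝ}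
    (ht : t ∈ Icc (0 : ℝ) 1) :
    (fun i => derivWithin (fun u => γ.toFun u i) (Icc 0 1) t) ∈ Z.tangentSpace (γ.toFun t) := by
  intro j
  have hd : ∀ i, HasDerivWithinAt (fun u => γ.toFun u i)
      (derivWithin (fun u => γ.toFun u i) (Icc 0 1) t) (Icc 0 1) t := fun i =>
    (((γ.contDiffOn_apply i).differentiableOn one_ne_zero) t ht).hasDerivWithinAt
  have hD := hasDerivWithinAt_eval_comp hd (Z.F j)
  have hzero : ∀ u ∈ Icc (0 : ℝ) 1, eval (γ.toFun u) (Z.F j) = 0 := fun u hu =>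
    (CurveData.mem_points.1 (γ.mem_points u hu)) j
  have hD0 : HasDerivWithinAt (fun u => eval (γ.toFun u) (Z.F j)) 0 (Icc 0 1) t :=
    (hasDerivWithinAt_const t (Icc (0 : ℝ) 1) (0 : ℂ)).congr (fun u hu => hzero u hu) (hzero t ht)
  have h := (uniqueDiffOn_Icc zero_lt_one t ht).eq_deriv _ hD hD0
  simpa [CurveData.gradient] using h

/-- **The velocity of a path on `E_L` is `c(t) · V(γ(t))`** with `c = ½ θ₀(γ)(γ′)`
(one-sided derivatives on `[0,1]`). [folklore] -/
theorem derivWithin_eq_mul_vf (γ : CurvePath (curve L)) {t : ℝ} (ht : t ∈ Icc (0 : ℝ) 1) (k : Fin 2) :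
    derivWithin (fun u => γ.toFun u k) (Icc 0 1) t =
      (1 / 2 * ∑ j, eval (γ.toFun t) (theta0 L j) * derivWithin (fun u => γ.toFun u j) (Icc 0 1) t) *
        vf L (γ.toFun t) k := by
  have hz := γ.mem_points t ht
  have hv := derivWithin_mem_tangentSpace γ ht
  fin_cases k
  · have h := Weier.z_one_mul_theta0_apply (A L) (B L) hz hv (disc_ne_zero L)
    simp only [vf_apply_zero, Fin.zero_eta]
    linear_combination -h
  · have h := fderiv_mul_theta0_apply L hz hv
    simp only [vf_apply_one, Fin.mk_one]
    linear_combination -(1 / 2 : ℂ) * h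

/-! ### Uniqueness: `φ ∘ γ̃ = γ` as long as `γ̃` stays off `Λ` -/

/-- **ODE comparison.** Let `γ` be a `C¹` path on `E_L`, `G : ℝ → ℂ` continuous with
`γ′ = G · V(γ)` on `[0,1]` (one-sided), and `γ̃` a primitive of `G` with `φ(γ̃(0)) = γ(0)`. If
`γ̃([0,T]) ∩ Λ = ∅` (`T ≤ 1`) then `φ ∘ γ̃ = γ` on `[0,T]`: both solve `w′ = G(t) V(w)`, which is
Lipschitz on bounded sets. [folklore] -/
theorem lift_eqOn (γ : CurvePath (curve L)) {γt G : ℝ → ℂ} (hG : Continuous G)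
    (hγd : ∀ t, HasDerivAt γt (G t) t)
    (hode : ∀ t ∈ Icc (0 : ℝ) 1, ∀ k,
      derivWithin (fun u => γ.toFun u k) (Icc 0 1) t = G t * vf L (γ.toFun t) k)
    (h0 : phi L (γt 0) = γ.toFun 0) {T : ℝ} (hT : T ∈ Icc (0 : ℝ) 1)
    (hP : ∀ u ∈ Icc 0 T, γt u ∉ L.lattice) :
    EqOn (fun u => phi L (γt u)) γ.toFun (Icc 0 T) := by
  have hTI : Icc 0 T ⊆ Icc (0 : ℝ) 1 := Icc_subset_Icc le_rfl hT.2
  -- continuity of both curves on `[0, T]`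
  have hFc : ContinuousOn (fun u => phi L (γt u)) (Icc 0 T) := by
    refine continuousOn_pi.2 fun k => ?_
    intro u hu
    have hcont : ContinuousAt (fun w => phi L w k) (γt u) := (hasDerivAt_phi L (hP u hu) k).continuousAt
    exact (hcont.comp (hγd u).continuousAt).continuousWithinAt
  have hγc : ContinuousOn γ.toFun (Icc 0 T) := γ.continuousOn.mono hTI
  -- a common ball and a Lipschitz constant
  obtain ⟨M, hM⟩ := (isCompact_Icc (a := (0 : ℝ)) (b := 1)).exists_bound_of_continuousOn
    hG.continuousOn
  obtain ⟨R₁, hR₁⟩ := (isCompact_Icc (a := (0 : ℝ)) (b := T)).exists_bound_of_continuousOn hFc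
  obtain ⟨R₂, hR₂⟩ := (isCompact_Icc (a := (0 : ℝ)) (b := T)).exists_bound_of_continuousOn hγc
  set R : ℝ := max (max R₁ R₂) 0 with hR
  have hR0 : 0 ≤ R := le_max_right _ _
  have hM0 : 0 ≤ max M 0 := le_max_right _ _
  have hv : ∀ t ∈ Ico 0 T, LipschitzOnWith (Real.toNNReal (max M 0 * (2 + 6 * R)))
      (fun w => G t • vf L w) (closedBall (0 : Fin 2 → ℂ) R) := by
    intro t ht
    refine LipschitzOnWith.of_dist_le' fun w hw w' hw' => ?_
    rw [dist_smul₀]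
    have h1 := dist_vf_le L hR0 hw hw'
    have h2 : ‖G t‖ ≤ max M 0 := (hM t ⟨ht.1, ht.2.le.trans hT.2⟩).trans (le_max_left _ _)
    have h3 : 0 ≤ dist (vf L w) (vf L w') := dist_nonneg
    calc ‖G t‖ * dist (vf L w) (vf L w') ≤ max M 0 * ((2 + 6 * R) * dist w w') :=
          mul_le_mul h2 h1 h3 hM0
      _ = max M 0 * (2 + 6 * R) * dist w w' := by ring
  -- `φ ∘ γ̃` solves the ODE
  have hf' : ∀ u ∈ Ico 0 T, HasDerivWithinAt (fun u => phi L (γt u))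
      (G u • vf L (phi L (γt u))) (Ici u) u := by
    intro u hu
    have huT : u ∈ Icc 0 T := ⟨hu.1, hu.2.le⟩
    have h : HasDerivAt (fun u => phi L (γt u)) (fun k => phiD L (γt u) k * G u) u :=
      hasDerivAt_pi.2 fun k => (hasDerivAt_phi L (hP u huT) k).comp u (hγd u)
    have e : (fun k => phiD L (γt u) k * G u) = G u • vf L (phi L (γt u)) := by
      rw [phiD_eq_vf]
      funext k
      simp [mul_comm]
    rw [e] at h
    exact h.hasDerivWithinAt
  -- `γ` solves the ODE
  have hg' : ∀ u ∈ Ico 0 T, HasDerivWithinAt γ.toFun (G u • vf L (γ.toFun u)) (Ici u) u := by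
    intro u hu
    have huI : u ∈ Icc (0 : ℝ) 1 := ⟨hu.1, hu.2.le.trans hT.2⟩
    have hd : HasDerivWithinAt γ.toFun (fun k => derivWithin (fun s => γ.toFun s k) (Icc 0 1) u)
        (Icc 0 1) u :=
      hasDerivWithinAt_pi.2 fun k =>
        (((γ.contDiffOn_apply k).differentiableOn one_ne_zero) u huI).hasDerivWithinAt
    have e : (fun k => derivWithin (fun s => γ.toFun s k) (Icc 0 1) u) = G u • vf L (γ.toFun u) := by
      funext k
      rw [hode u huI k]
      simp
    rw [e] at hd
    have hu1 : u < 1 := hu.2.trans_le hT.2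
    have hmem : Icc (0 : ℝ) 1 ∈ 𝓝[≥] u :=
      mem_of_superset (Icc_mem_nhdsGE hu1) (Icc_subset_Icc hu.1 le_rfl)
    exact hd.mono_of_mem_nhdsWithin hmem
  have hfs : ∀ u ∈ Ico 0 T, phi L (γt u) ∈ closedBall (0 : Fin 2 → ℂ) R := fun u hu => by
    rw [mem_closedBall_zero_iff]
    exact (hR₁ u ⟨hu.1, hu.2.le⟩).trans ((le_max_left _ _).trans (le_max_left _ _))
  have hgs : ∀ u ∈ Ico 0 T, γ.toFun u ∈ closedBall (0 : Fin 2 → ℂ) R := fun u hu => by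
    rw [mem_closedBall_zero_iff]
    exact (hR₂ u ⟨hu.1, hu.2.le⟩).trans ((le_max_right _ _).trans (le_max_left _ _))
  exact ODE_solution_unique_of_mem_Icc_right (v := fun t w => G t • vf L w)
    (s := fun _ => closedBall (0 : Fin 2 → ℂ) R) hv hFc hf' hfs hγc hg' hgs h0

/-! ### The lifting theorem -/

/-- **Path lifting through `φ`.** Every `C¹` path `γ : [0,1] → E_L(ℂ)` with algebraic end points
(indeed any `CurvePath` on `E_L`) is `φ ∘ γ̃` on `[0,1]` for a `C¹` function `γ̃ : ℝ → ℂ` avoiding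
`Λ` on `[0,1]`; explicitly `γ̃ = z₀ + ½∫₀ θ₀(γ) γ′`. [cite: HuberWustholz2022, §3.3.1 (p. 44), §18.1 (p. 160)] -/
theorem exists_lift (γ : CurvePath (curve L)) :
    ∃ γt : ℝ → ℂ, ContDiff ℝ 1 γt ∧ (∀ t ∈ Icc (0 : ℝ) 1, γt t ∉ L.lattice) ∧
      ∀ t ∈ Icc (0 : ℝ) 1, phi L (γt t) = γ.toFun t := by
  have hI : (0 : ℝ) ∈ Icc (0 : ℝ) 1 := ⟨le_rfl, zero_le_one⟩
  -- the integrand `c = ½ θ₀(γ)(γ′)` on `[0,1]`, extended continuously to `ℝ`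
  obtain ⟨c, hc⟩ : ∃ c : ℝ → ℂ, c = fun t => 1 / 2 * ∑ j, eval (γ.toFun t) (theta0 L j) *
      derivWithin (fun u => γ.toFun u j) (Icc 0 1) t := ⟨_, rfl⟩
  have hcc : ContinuousOn c (Icc 0 1) := by
    rw [hc]
    refine continuousOn_const.mul (continuousOn_finsetSum _ fun j _ => ?_)
    exact (γ.continuousOn_eval _).mul (γ.continuousOn_derivWithin j)
  obtain ⟨G, hG⟩ : ∃ G : ℝ → ℂ, G = fun t => c (projIcc 0 1 zero_le_one t) := ⟨_, rfl⟩
  have hGc : Continuous G := by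
    rw [hG]
    exact hcc.comp_continuous (continuous_subtype_val.comp continuous_projIcc)
      fun t => (projIcc 0 1 zero_le_one t).2
  have hGc' : ∀ t ∈ Icc (0 : ℝ) 1, G t = c t := fun t ht => by
    simp only [hG, projIcc_of_mem zero_le_one ht]
  -- the initial point and the primitive
  obtain ⟨z₀, hz₀, hφ₀⟩ := exists_phi_eq L (γ.mem_points 0 hI)
  obtain ⟨γt, hγt⟩ : ∃ γt : ℝ → ℂ, γt = fun t => z₀ + ∫ u in (0 : ℝ)..t, G u := ⟨_, rfl⟩
  have hγd : ∀ t, HasDerivAt γt (G t) t := fun t => by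
    rw [hγt]
    exact ((hGc.integral_hasStrictDerivAt 0 t).hasDerivAt).const_add _
  have hderiv : deriv γt = G := funext fun t => (hγd t).deriv
  have hC1 : ContDiff ℝ 1 γt :=
    contDiff_one_iff_deriv.2 ⟨fun t => (hγd t).differentiableAt, hderiv ▸ hGc⟩
  have hγ0 : γt 0 = z₀ := by simp [hγt]
  have h0 : phi L (γt 0) = γ.toFun 0 := by rw [hγ0, hφ₀]
  -- the ODE satisfied by `γ`
  have hode : ∀ t ∈ Icc (0 : ℝ) 1, ∀ k,
      derivWithin (fun u => γ.toFun u k) (Icc 0 1) t = G t * vf L (γ.toFun t) k := by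
    intro t ht k
    rw [hGc' t ht, hc]
    exact derivWithin_eq_mul_vf L γ ht k
  -- `γ̃` never meets `Λ` on `[0,1]`
  have key : ∀ t ∈ Icc (0 : ℝ) 1, γt t ∉ L.lattice := by
    by_contra hcon
    push Not at hcon
    set Bad : Set ℝ := Icc 0 1 ∩ γt ⁻¹' (L.lattice : Set ℂ) with hBad
    have hne : Bad.Nonempty := by
      obtain ⟨t, ht, h⟩ := hcon
      exact ⟨t, ht, h⟩
    have hcl : IsClosed Bad := isClosed_Icc.inter (L.isClosed_lattice.preimage hC1.continuous)
    have hbdd : BddBelow Bad := ⟨0, fun t ht => ht.1.1⟩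
    set T := sInf Bad with hTdef
    have hTmem : T ∈ Bad := hcl.csInf_mem hne hbdd
    have hTI : T ∈ Icc (0 : ℝ) 1 := hTmem.1
    have hl : γt T ∈ L.lattice := hTmem.2
    have hT0 : 0 < T := by
      rcases hTI.1.eq_or_lt with h | h
      · exact absurd (by rw [← h, hγ0] at hl; exact hl) hz₀
      · exact h
    have hbelow : ∀ u, 0 ≤ u → u < T → γt u ∉ L.lattice := fun u hu0 huT h => by
      have h' := csInf_le hbdd ⟨⟨hu0, huT.le.trans hTI.2⟩, h⟩
      exact absurd h' (not_le.2 huT)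
    -- below `T`, `φ ∘ γ̃ = γ`
    have heq : ∀ u, 0 ≤ u → u < T → phi L (γt u) = γ.toFun u := fun u hu0 huT =>
      lift_eqOn L γ hGc hγd hode h0 (T := u) ⟨hu0, huT.le.trans hTI.2⟩
        (fun w hw => hbelow w hw.1 (hw.2.trans_lt huT)) (right_mem_Icc.2 hu0)
    -- blow-up of `℘(γ̃(u)) = x(u)` as `u ↑ T`
    have h1 : Tendsto (fun u => ℘[L] (γt u)) (𝓝[<] T) (cobounded ℂ) := by
      refine (L.tendsto_weierstrassP_cobounded hl).comp ?_
      refine tendsto_nhdsWithin_of_tendsto_nhds_of_eventually_within _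
        ((hγd T).continuousAt.tendsto.mono_left nhdsWithin_le_nhds) ?_
      filter_upwards [Ioo_mem_nhdsLT hT0] with u hu
      exact fun h => hbelow u hu.1.le hu.2 (by rw [mem_singleton_iff] at h; rw [h]; exact hl)
    have h2 : Tendsto (fun u => ℘[L] (γt u)) (𝓝[<] T) (𝓝 (γ.toFun T 0)) := by
      have hγT : ContinuousWithinAt (fun u => γ.toFun u 0) (Icc 0 1) T :=
        (continuous_apply 0).continuousAt.comp_continuousWithinAt (γ.continuousOn T hTI)
      have hsub : Ioo 0 T ⊆ Icc (0 : ℝ) 1 := fun u hu => ⟨hu.1.le, hu.2.le.trans hTI.2⟩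
      have ht : Tendsto (fun u => γ.toFun u 0) (𝓝[<] T) (𝓝 (γ.toFun T 0)) := by
        rw [← nhdsWithin_Ioo_eq_nhdsLT hT0]
        exact hγT.tendsto.mono_left (nhdsWithin_mono _ hsub)
      refine ht.congr' ?_
      filter_upwards [Ioo_mem_nhdsLT hT0] with u hu
      have h := congrFun (heq u hu.1.le hu.2) 0
      simpa using h.symm
    exact absurd h1 (h2.not_tendsto (disjoint_nhds_cobounded _))
  exact ⟨γt, hC1, key, fun t ht => lift_eqOn L γ hGc hγd hode h0 (T := 1) ⟨zero_le_one, le_rfl⟩ key ht⟩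

/-- The end points of a lift are algebraic points (as the end points of `γ` are). [folklore] -/
theorem isAlgPt_of_phi_eq {z : ℂ} (hz : z ∉ L.lattice) {p : Fin 2 → ℂ}
    (hp : ∀ k, IsAlgebraic ℚ (p k)) (h : phi L z = p) : IsAlgPt L z :=
  ⟨hz, fun k => by rw [h]; exact hp k⟩

/-- **Path lifting with algebraic end points**: as `exists_lift`, recording that `γ̃(0)` and
`γ̃(1)` are algebraic points. [cite: HuberWustholz2022, §3.3.1 (p. 44)] -/
theorem exists_lift' (γ : CurvePath (curve L)) :
    ∃ γt : ℝ → ℂ, ContDiff ℝ 1 γt ∧ (∀ t ∈ Icc (0 : ℝ) 1, γt t ∉ L.lattice) ∧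
      (∀ t ∈ Icc (0 : ℝ) 1, phi L (γt t) = γ.toFun t) ∧ IsAlgPt L (γt 0) ∧ IsAlgPt L (γt 1) := by
  obtain ⟨γt, hC1, hΛ, hφ⟩ := exists_lift L γ
  have h0 : (0 : ℝ) ∈ Icc (0 : ℝ) 1 := ⟨le_rfl, zero_le_one⟩
  have h1 : (1 : ℝ) ∈ Icc (0 : ℝ) 1 := ⟨zero_le_one, le_rfl⟩
  exact ⟨γt, hC1, hΛ, hφ, isAlgPt_of_phi_eq L (hΛ 0 h0) γ.algebraic_zero (hφ 0 h0),
    isAlgPt_of_phi_eq L (hΛ 1 h1) γ.algebraic_one (hφ 1 h1)⟩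

/-- For a CLOSED path the lift changes by a lattice vector: `γ̃(1) − γ̃(0) ∈ Λ`
(`φ(γ̃(1)) = φ(γ̃(0))`, `PeriodPair.sub_mem_lattice_of_weierstrassP_eq`). [folklore] -/
theorem lift_sub_mem_lattice {γt : ℝ → ℂ} {γ : CurvePath (curve L)}
    (hΛ : ∀ t ∈ Icc (0 : ℝ) 1, γt t ∉ L.lattice)
    (hφ : ∀ t ∈ Icc (0 : ℝ) 1, phi L (γt t) = γ.toFun t) (hclosed : γ.toFun 1 = γ.toFun 0) :
    γt 1 - γt 0 ∈ L.lattice := by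
  have h0 : (0 : ℝ) ∈ Icc (0 : ℝ) 1 := ⟨le_rfl, zero_le_one⟩
  have h1 : (1 : ℝ) ∈ Icc (0 : ℝ) 1 := ⟨zero_le_one, le_rfl⟩
  have h : phi L (γt 1) = phi L (γt 0) := by rw [hφ 1 h1, hφ 0 h0, hclosed]
  have hx := congrFun h 0
  have hy := congrFun h 1
  simp only [phi_apply_zero, phi_apply_one] at hx hy
  exact L.sub_mem_lattice_of_weierstrassP_eq (hΛ 1 h1) (hΛ 0 h0) hx (by linear_combination 2 * hy)

end Ell

end CurvePeriods

end Literature.NumberTheory.Transcendental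

end
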